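import Mathlib
import Literature.NumberTheory.LFunctions.Zhang2022.Section16AEq1612Assembly
import HarnessLib

/-!
# Zhang (2022) §16, (16.12) from (16.5) and a WEIGHTED, POLYNOMIAL-RATE (16.10): the insertion bookkeeping
# with the Euler-product weight `∏_{q∣dl}(1 + c₀q^{−9/10})` — kernel-checked edge

Topic `Literature/NumberTheory/LFunctions/Zhang2022` (Landau–Siegel audit tree; verdict-neutral).
Y. Zhang, *Discrete mean estimates and the Landau–Siegel zero*, arXiv:2211.02515v1 (2022)
[Zhang2022LandauSiegel] — **an unrefereed manuscript under adjudication** (ZHANG-L discharge lane, WP16,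
leaf `Typed.Section16A.Eq16_12 c′`). Companion of `Zhang2022/Section16AEq1612Assembly.lean` (the edge
`eq16_12_of_insertion`): here the summed insertion hypothesis is derived from a POINTWISE form of (16.10)
[Z22 p. 92, tex L4550] whose error is NOT the printed uniform `O(ε₁)` but
`C·∏_{q∣dl}(1 + c₀/q^{9/10})·𝓛⁻¹²⁰` — the shape an honest contour-shift proof of (16.10) delivers (the
manuscript itself notes at the parallel (15.16), tex L4221, that "the function also has a simple pole at
`s = ρ̃ − 1`, while the residue at this point can be regarded as an acceptable error": that residue is
polynomially, not exponentially, small in `𝓛`, and it carries the size of `ℳ₂(d,l;ρ̃) ≪ ∏_{q∣dl}(1+cq^{−9/10})`,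
§16.u022). READING REMARK, not a repair: the typed node `Eq16_10` (uniform `O(ε₁)`, range `dl < P₂²`,
`(dl,D)=1`) is neither targeted nor asserted here; what (16.12) needs is exactly the hypothesis below.

* `prod_primeFactors_weight_le` — `∏_{q∣n}(1 + c₀q^{−9/10}) ≤ (1+c₀)^{⌈c₀⌉²+1}·τ₂(n)` (the primes `q ≤ ⌈c₀⌉²`
  give at most `(1+c₀)` each, the others at most `2` each, and `2^{ω(n)} ≤ τ₂(n)`);
* `sum_tau_three_mul_tau_two_sq_div_le` — `Σ_{n≤X} τ₃(n)τ₂(n)²/n ≤ M·(log X)¹²` (Euler-product majorant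
  `MeanSquareMajorant.sum_div_le`: value `12` at primes, `≤ (ν+1)⁷` at prime powers);
* `sum_weights_weighted_le` — `Σ_{d,l<⌈P⌉}|b₁(dl)|/(dl)·∏_{q∣dl}(1+c₀q^{−9/10}) ≤ C_b(1+c₀)^{⌈c₀⌉²+1}M(2𝓛⁹)¹²`
  (substitution `n = dl`, `|b₁| ≤ C_bτ₃`);
* `eq16_12_of_eq16_5P_of_eq16_10_weighted` — **(16.12) ⇐ (16.5)ᴾ + the weighted polynomial (16.10) on the
  support of `b₁`** (`|ℛ₂*|·(D/φ(D)) ≪ 𝓛²`, so the inserted error is `≪ 𝓛^{2+108−120} = o(1)`), via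
  `eq16_12_of_insertion`.

No new definitions, no named facts, no `sorry`; (16.5)ᴾ and the weighted (16.10) are hypotheses, never asserted.
Nothing here bears on Theorems 1–2 of the source or on Landau–Siegel zeros.

## References

* Y. Zhang, arXiv:2211.02515v1 (2022), §16 (16.10)–(16.12) p. 92 tex L4549–L4565, u022 p. 91 tex L4541;
  §15 (15.15)–(15.16) p. 85 tex L4217–L4224. [cite: Zhang2022LandauSiegel, §16 (16.12) p.92]
-/

noncomputable section

open Complex Real
open Literature.NumberTheory.LFunctions.Zhang2022
open Literature.NumberTheory.LFunctions.Zhang2022.Skeleton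
open Literature.NumberTheory.LFunctions.Zhang2022.Typed.Section16ALeaves

namespace Literature.NumberTheory.LFunctions.Zhang2022.Typed.Section16A

/-! ## The Euler-product weight against `τ₂` -/

/-- `2^{ω(n)} ≤ τ₂(n)` (`n ≥ 1`): `τ₂(n) = ∏_{p∣n}(v_p(n)+1)` with every factor `≥ 2`. [folklore] -/
private theorem two_pow_card_primeFactors_le {n : ℕ} (hn : n ≠ 0) :
    (2 : ℝ) ^ n.primeFactors.card ≤ MeanSquareMajorant.tau 2 n := by
  rw [MeanSquareMajorant.tau_two_apply]
  have h : 2 ^ n.primeFactors.card ≤ n.divisors.card := by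
    rw [Nat.card_divisors hn]
    refine Finset.pow_card_le_prod _ _ _ fun p hp => ?_
    have : 0 < n.factorization p := Nat.Prime.factorization_pos_of_dvd (Nat.prime_of_mem_primeFactors hp)
      hn (Nat.dvd_of_mem_primeFactors hp)
    omega
  exact_mod_cast h

/-- **The Euler-product weight is at most a constant times `τ₂`**: for `c₀ ≥ 0` and `n ≥ 1`,
`∏_{q∣n}(1 + c₀/q^{9/10}) ≤ (1+c₀)^{⌈c₀⌉²+1}·τ₂(n)` — primes `q ≤ ⌈c₀⌉²` contribute `≤ 1 + c₀` each (there are at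
most `⌈c₀⌉²+1` of them), primes `q > ⌈c₀⌉²` have `q^{9/10} ≥ √q ≥ c₀`, so contribute `≤ 2` each, and
`2^{ω(n)} ≤ τ₂(n)`. [cite: Zhang2022LandauSiegel, §16 p.91 (u022)] -/
theorem prod_primeFactors_weight_le {c₀ : ℝ} (hc : 0 ≤ c₀) {n : ℕ} (hn : n ≠ 0) :
    ∏ q ∈ n.primeFactors, (1 + c₀ / (q : ℝ) ^ (9 / 10 : ℝ)) ≤
      (1 + c₀) ^ (⌈c₀⌉₊ ^ 2 + 1) * MeanSquareMajorant.tau 2 n := by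
  set Q₀ : ℕ := ⌈c₀⌉₊ ^ 2 with hQ₀
  have hfac_nonneg : ∀ q ∈ n.primeFactors, 0 ≤ 1 + c₀ / (q : ℝ) ^ (9 / 10 : ℝ) := fun q _ => by positivity
  have hfac_small : ∀ q ∈ n.primeFactors, 1 + c₀ / (q : ℝ) ^ (9 / 10 : ℝ) ≤ 1 + c₀ := by
    intro q hq
    have hq1 : (1 : ℝ) ≤ q := by exact_mod_cast (Nat.prime_of_mem_primeFactors hq).one_le
    have hq9 : (1 : ℝ) ≤ (q : ℝ) ^ (9 / 10 : ℝ) := Real.one_le_rpow hq1 (by norm_num)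
    have : c₀ / (q : ℝ) ^ (9 / 10 : ℝ) ≤ c₀ := div_le_self hc hq9
    linarith
  have hfac_large : ∀ q ∈ n.primeFactors, ¬ q ≤ Q₀ → 1 + c₀ / (q : ℝ) ^ (9 / 10 : ℝ) ≤ 2 := by
    intro q hq hqQ
    have hq1 : (1 : ℝ) ≤ q := by exact_mod_cast (Nat.prime_of_mem_primeFactors hq).one_le
    have hqQ' : (Q₀ : ℝ) ≤ q := by exact_mod_cast (not_le.mp hqQ).le
    -- `c₀ ≤ ⌈c₀⌉ = √(⌈c₀⌉²) ≤ √q ≤ q^{9/10}`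
    have h1 : c₀ ≤ Real.sqrt (q : ℝ) := by
      have hc' : c₀ ≤ (⌈c₀⌉₊ : ℝ) := Nat.le_ceil _
      have : Real.sqrt ((⌈c₀⌉₊ : ℝ) ^ 2) = (⌈c₀⌉₊ : ℝ) := Real.sqrt_sq (Nat.cast_nonneg _)
      have hQR : ((⌈c₀⌉₊ : ℝ) ^ 2) ≤ q := by rw [hQ₀] at hqQ'; exact_mod_cast hqQ'
      calc c₀ ≤ (⌈c₀⌉₊ : ℝ) := hc'
        _ = Real.sqrt ((⌈c₀⌉₊ : ℝ) ^ 2) := this.symm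
        _ ≤ Real.sqrt q := Real.sqrt_le_sqrt hQR
    have h2 : Real.sqrt (q : ℝ) ≤ (q : ℝ) ^ (9 / 10 : ℝ) := by
      rw [Real.sqrt_eq_rpow]
      exact Real.rpow_le_rpow_of_exponent_le hq1 (by norm_num)
    have hq9pos : 0 < (q : ℝ) ^ (9 / 10 : ℝ) := by positivity
    have : c₀ / (q : ℝ) ^ (9 / 10 : ℝ) ≤ 1 := by
      rw [div_le_one hq9pos]; exact h1.trans h2
    linarith
  rw [← Finset.prod_filter_mul_prod_filter_not n.primeFactors (fun q => q ≤ Q₀)]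
  have hA : ∏ q ∈ n.primeFactors.filter (fun q => q ≤ Q₀), (1 + c₀ / (q : ℝ) ^ (9 / 10 : ℝ)) ≤
      (1 + c₀) ^ (Q₀ + 1) := by
    have h1 : ∏ q ∈ n.primeFactors.filter (fun q => q ≤ Q₀), (1 + c₀ / (q : ℝ) ^ (9 / 10 : ℝ)) ≤
        (1 + c₀) ^ (n.primeFactors.filter (fun q => q ≤ Q₀)).card := by
      rw [← Finset.prod_const]
      exact Finset.prod_le_prod (fun q hq => hfac_nonneg q (Finset.mem_filter.mp hq).1)
        fun q hq => hfac_small q (Finset.mem_filter.mp hq).1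
    have hcard : (n.primeFactors.filter (fun q => q ≤ Q₀)).card ≤ Q₀ + 1 := by
      calc (n.primeFactors.filter (fun q => q ≤ Q₀)).card ≤ (Finset.range (Q₀ + 1)).card :=
            Finset.card_le_card fun q hq => by
              simp only [Finset.mem_filter] at hq; simp only [Finset.mem_range]; omega
        _ = Q₀ + 1 := Finset.card_range _
    exact h1.trans (pow_le_pow_right₀ (by linarith) hcard)
  have hB : ∏ q ∈ n.primeFactors.filter (fun q => ¬ q ≤ Q₀), (1 + c₀ / (q : ℝ) ^ (9 / 10 : ℝ)) ≤
      MeanSquareMajorant.tau 2 n := by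
    have h1 : ∏ q ∈ n.primeFactors.filter (fun q => ¬ q ≤ Q₀), (1 + c₀ / (q : ℝ) ^ (9 / 10 : ℝ)) ≤
        (2 : ℝ) ^ (n.primeFactors.filter (fun q => ¬ q ≤ Q₀)).card := by
      rw [← Finset.prod_const]
      exact Finset.prod_le_prod (fun q hq => hfac_nonneg q (Finset.mem_filter.mp hq).1)
        fun q hq => hfac_large q (Finset.mem_filter.mp hq).1 (Finset.mem_filter.mp hq).2
    have h2 : (2 : ℝ) ^ (n.primeFactors.filter (fun q => ¬ q ≤ Q₀)).card ≤ (2 : ℝ) ^ n.primeFactors.card :=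
      pow_le_pow_right₀ (by norm_num) (Finset.card_le_card (Finset.filter_subset _ _))
    exact h1.trans (h2.trans (two_pow_card_primeFactors_le hn))
  have hA0 : 0 ≤ ∏ q ∈ n.primeFactors.filter (fun q => q ≤ Q₀), (1 + c₀ / (q : ℝ) ^ (9 / 10 : ℝ)) :=
    Finset.prod_nonneg fun q hq => hfac_nonneg q (Finset.mem_filter.mp hq).1
  have hB0 : 0 ≤ ∏ q ∈ n.primeFactors.filter (fun q => ¬ q ≤ Q₀), (1 + c₀ / (q : ℝ) ^ (9 / 10 : ℝ)) :=
    Finset.prod_nonneg fun q hq => hfac_nonneg q (Finset.mem_filter.mp hq).1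
  exact mul_le_mul hA hB hB0 (by positivity)

/-! ## `Σ_{n≤X} τ₃(n)τ₂(n)²/n ≪ (log X)¹²` -/

/-- **`Σ_{n≤X} τ₃(n)τ₂(n)²/n ≤ M·(log X)¹²`** for `X ≥ 2` (`M = majorantConst 12 7`): `τ₃τ₂²` is multiplicative,
equals `12` at primes and is `≤ (ν+1)⁷` at `p^ν` (Euler-product majorant `MeanSquareMajorant.sum_div_le`).
[cite: Zhang2022LandauSiegel, §16 (16.12) p.92] -/
theorem sum_tau_three_mul_tau_two_sq_div_le {X : ℕ} (hX : 2 ≤ X) :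
    ∑ n ∈ Finset.Icc 1 X, MeanSquareMajorant.tau 3 n * MeanSquareMajorant.tau 2 n ^ 2 / n ≤
      MeanSquareMajorant.majorantConst 12 7 * Real.log X ^ 12 := by
  have hm3 := MeanSquareMajorant.isMultiplicative_tau 3
  have hm2 := MeanSquareMajorant.isMultiplicative_tau 2
  have h := MeanSquareMajorant.sum_div_le
    (f := fun n => MeanSquareMajorant.tau 3 n * MeanSquareMajorant.tau 2 n ^ 2) (a := 12) (d := 7) (K := 0)
    (by simp [MeanSquareMajorant.tau_apply_one])
    (fun m n hmn => by
      simp only [hm3.map_mul_of_coprime hmn, hm2.map_mul_of_coprime hmn]; ring)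
    (fun n => mul_nonneg (MeanSquareMajorant.tau_nonneg _ _) (sq_nonneg _)) le_rfl
    (fun p hp => by
      rw [MeanSquareMajorant.tau_prime 3 hp, MeanSquareMajorant.tau_prime 2 hp]; norm_num)
    (fun p ν hp => by
      have h3 := MeanSquareMajorant.tau_prime_pow_le 3 hp ν
      have h2 := MeanSquareMajorant.tau_prime_pow_le 2 hp ν
      have h0 : 0 ≤ MeanSquareMajorant.tau 2 (p ^ ν) := MeanSquareMajorant.tau_nonneg _ _
      have h30 : 0 ≤ MeanSquareMajorant.tau 3 (p ^ ν) := MeanSquareMajorant.tau_nonneg _ _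
      calc MeanSquareMajorant.tau 3 (p ^ ν) * MeanSquareMajorant.tau 2 (p ^ ν) ^ 2
          ≤ ((ν : ℝ) + 1) ^ 3 * (((ν : ℝ) + 1) ^ 2) ^ 2 :=
            mul_le_mul h3 (pow_le_pow_left₀ h0 h2 2) (sq_nonneg _) (by positivity)
        _ = ((ν : ℝ) + 1) ^ 7 := by ring) hX
  simpa only [zero_mul, Real.exp_zero, mul_one] using h

/-! ## The weighted weights -/

section Main

variable (c' : ℝ)

/-- **The weighted weights of the insertion sum to a power of `𝓛`**: for `log D ≥ 10` and `c₀ ≥ 0`,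
`Σ_{d<⌈P⌉}Σ_{l<⌈P⌉} |b₁(dl)|/(dl)·∏_{q∣dl}(1+c₀q^{−9/10}) ≤ C_b·(1+c₀)^{⌈c₀⌉²+1}·M·(2𝓛⁹)¹²` (substitution
`n = dl`, `|b₁| ≤ C_bτ₃`, `prod_primeFactors_weight_le`, `sum_tau_three_mul_tau_two_sq_div_le`).
[cite: Zhang2022LandauSiegel, §16 (16.12) p.92] -/
theorem sum_weights_weighted_le {D : ℕ} [NeZero D] (χ : DirichletCharacter ℂ D) (hℓ : 10 ≤ ell D)
    {c₀ : ℝ} (hc : 0 ≤ c₀) :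
    ∑ d ∈ Finset.Ico 1 ⌈bigP D⌉₊, ∑ l ∈ Finset.Ico 1 ⌈bigP D⌉₊, ‖b1coef c' χ (d * l)‖ / ((d : ℝ) * l) *
        ∏ q ∈ (d * l).primeFactors, (1 + c₀ / (q : ℝ) ^ (9 / 10 : ℝ)) ≤
      ((1 + ‖iota2‖) * (‖iota3‖ + ‖iota4‖)) * (1 + c₀) ^ (⌈c₀⌉₊ ^ 2 + 1) *
        MeanSquareMajorant.majorantConst 12 7 * (2 * ell D ^ 9) ^ 12 := by
  set N : ℕ := ⌈bigP D⌉₊ with hN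
  set Cb : ℝ := (1 + ‖iota2‖) * (‖iota3‖ + ‖iota4‖) with hCb
  set Kc : ℝ := (1 + c₀) ^ (⌈c₀⌉₊ ^ 2 + 1) with hKc
  have hCb0 : 0 ≤ Cb := by positivity
  have hKc0 : 0 ≤ Kc := by positivity
  have hℓ2 : 2 ≤ ell D := by linarith
  set w : ℕ → ℝ := fun n => ∏ q ∈ n.primeFactors, (1 + c₀ / (q : ℝ) ^ (9 / 10 : ℝ)) with hw
  have hw0 : ∀ n, 0 ≤ w n := fun n => Finset.prod_nonneg fun q _ => by positivity
  -- substitution `n = dl`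
  have hsupp : ∀ q : ℕ × ℕ, 1 ≤ q.1 → 1 ≤ q.2 → N ≤ q.1 * q.2 →
      ‖b1coef c' χ (q.1 * q.2)‖ / ((q.1 : ℝ) * q.2) * w (q.1 * q.2) = 0 := by
    intro q _ _ hq
    rw [b1coef_eq_zero_of_le c' χ ((suppBound_le_bigP hℓ).trans
      ((Nat.le_ceil _).trans (by exact_mod_cast hq))), norm_zero, zero_div, zero_mul]
  have hre := sum_Ico_Ico_eq_sum_divisorsAntidiagonal N
    (fun q : ℕ × ℕ => ‖b1coef c' χ (q.1 * q.2)‖ / ((q.1 : ℝ) * q.2) * w (q.1 * q.2)) hsupp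
  simp only [hw] at hre ⊢
  rw [hre]
  -- each fibre: `Σ_{dl=n} |b₁(n)|/n·w(n) = τ₂(n)|b₁(n)|w(n)/n ≤ C_b K_c τ₃(n)τ₂(n)²/n`
  have hfib : ∀ n ∈ Finset.Ico 1 N,
      ∑ q ∈ n.divisorsAntidiagonal, ‖b1coef c' χ (q.1 * q.2)‖ / ((q.1 : ℝ) * q.2) *
          ∏ x ∈ (q.1 * q.2).primeFactors, (1 + c₀ / (x : ℝ) ^ (9 / 10 : ℝ)) ≤
        Cb * Kc * (MeanSquareMajorant.tau 3 n * MeanSquareMajorant.tau 2 n ^ 2 / n) := by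
    intro n hn
    have hn1 : 1 ≤ n := (Finset.mem_Ico.mp hn).1
    have hn0 : n ≠ 0 := by omega
    have hnR : (0 : ℝ) < n := by exact_mod_cast hn1
    have hterm : ∀ q ∈ n.divisorsAntidiagonal,
        ‖b1coef c' χ (q.1 * q.2)‖ / ((q.1 : ℝ) * q.2) *
            ∏ x ∈ (q.1 * q.2).primeFactors, (1 + c₀ / (x : ℝ) ^ (9 / 10 : ℝ)) =
          ‖b1coef c' χ n‖ / n * w n := by
      intro q hq
      have hprod : q.1 * q.2 = n := (Nat.mem_divisorsAntidiagonal.mp hq).1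
      rw [hprod, show ((q.1 : ℝ) * q.2) = (n : ℝ) by rw [← hprod]; push_cast; ring]
    rw [Finset.sum_congr rfl hterm, Finset.sum_const, nsmul_eq_mul]
    have hcard : (n.divisorsAntidiagonal.card : ℝ) = MeanSquareMajorant.tau 2 n := by
      rw [MeanSquareMajorant.tau_two_apply, ← Nat.map_div_right_divisors, Finset.card_map]
    rw [hcard]
    have hb := Skeleton.norm_b1coef_le c' χ hℓ2 n
    rw [one_mul] at hb
    have hwn : w n ≤ Kc * MeanSquareMajorant.tau 2 n := prod_primeFactors_weight_le hc hn0
    have hτ20 : 0 ≤ MeanSquareMajorant.tau 2 n := MeanSquareMajorant.tau_nonneg _ _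
    have hτ30 : 0 ≤ MeanSquareMajorant.tau 3 n := MeanSquareMajorant.tau_nonneg _ _
    calc MeanSquareMajorant.tau 2 n * (‖b1coef c' χ n‖ / n * w n)
        ≤ MeanSquareMajorant.tau 2 n * (Cb * MeanSquareMajorant.tau 3 n / n * (Kc * MeanSquareMajorant.tau 2 n)) := by
          refine mul_le_mul_of_nonneg_left ?_ hτ20
          exact mul_le_mul (div_le_div_of_nonneg_right hb hnR.le) hwn (hw0 n) (by positivity)
      _ = Cb * Kc * (MeanSquareMajorant.tau 3 n * MeanSquareMajorant.tau 2 n ^ 2 / n) := by ring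
  refine (Finset.sum_le_sum hfib).trans ?_
  rw [← Finset.mul_sum]
  -- `Σ_{n<N} τ₃τ₂²/n ≤ M (log(N-1))¹² ≤ M (2𝓛⁹)¹²`
  have hP1 : (3 : ℝ) ≤ bigP D := by
    have h9 : (10 : ℝ) ^ 9 ≤ ell D ^ 9 := by gcongr
    have := Real.add_one_le_exp (ell D ^ 9)
    rw [bigP]; linarith
  have hN3 : 3 ≤ N := by
    have h : (3 : ℝ) ≤ (N : ℝ) := hP1.trans (Nat.le_ceil _)
    exact_mod_cast h
  have hX2 : 2 ≤ N - 1 := by omega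
  have hIco : Finset.Ico 1 N = Finset.Icc 1 (N - 1) := by
    ext n; simp only [Finset.mem_Ico, Finset.mem_Icc]; omega
  rw [hIco]
  have hsum := sum_tau_three_mul_tau_two_sq_div_le hX2
  have hlog : Real.log ((N - 1 : ℕ) : ℝ) ≤ 2 * ell D ^ 9 := by
    have hN1 : ((N - 1 : ℕ) : ℝ) ≤ bigP D := by
      have h1 : ((N - 1 : ℕ) : ℝ) = (N : ℝ) - 1 := by
        rw [Nat.cast_sub (by omega)]; push_cast; ring
      rw [h1, hN]
      have := Nat.ceil_lt_add_one (show (0 : ℝ) ≤ bigP D by positivity)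
      linarith
    have hpos : (0 : ℝ) < ((N - 1 : ℕ) : ℝ) := by exact_mod_cast (show 0 < N - 1 by omega)
    calc Real.log ((N - 1 : ℕ) : ℝ) ≤ Real.log (bigP D) := Real.log_le_log hpos hN1
      _ = ell D ^ 9 := by rw [bigP, Real.log_exp]
      _ ≤ 2 * ell D ^ 9 := by nlinarith [pow_nonneg (show (0:ℝ) ≤ ell D by linarith) 9]
  have hlog0 : 0 ≤ Real.log ((N - 1 : ℕ) : ℝ) := Real.log_natCast_nonneg _
  have hM0 : 0 ≤ MeanSquareMajorant.majorantConst 12 7 := (MeanSquareMajorant.majorantConst_pos _ _).le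
  calc Cb * Kc * ∑ n ∈ Finset.Icc 1 (N - 1),
        MeanSquareMajorant.tau 3 n * MeanSquareMajorant.tau 2 n ^ 2 / (n : ℝ)
      ≤ Cb * Kc * (MeanSquareMajorant.majorantConst 12 7 * Real.log ((N - 1 : ℕ) : ℝ) ^ 12) :=
        mul_le_mul_of_nonneg_left hsum (by positivity)
    _ ≤ Cb * Kc * (MeanSquareMajorant.majorantConst 12 7 * (2 * ell D ^ 9) ^ 12) := by gcongr
    _ = _ := by ring

/-! ## (16.12) from (16.5)ᴾ and the weighted polynomial (16.10) -/

/-- **(16.12) ⇐ (16.5)ᴾ + (16.10) in weighted polynomial form on the support of `b₁`** (§16 p. 92): if, for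
all large `D` under (A), every `d, l ≥ 1` with `dl < 2T²P^{1/2}max(P₂,P₃)` and `(l,D) = 1` satisfies
`|𝒟₂(d,l) − λ₂(d)Σⱼℛ₂ⱼd^{β_j}ℳ₂(d,l;1−β_j)| ≤ C·∏_{q∣dl}(1 + c₀/q^{9/10})·𝓛⁻¹²⁰`, then (16.5)ᴾ gives (16.12):
the inserted error is `≤ |ℛ₂*|·(D/φ(D))·C𝓛⁻¹²⁰·Σ_{d,l}|b₁(dl)|/(dl)·∏(…) ≪ 𝓛^{2+108−120} = o(1)`
(`norm_calR2star_le`, `self_div_totient_le_ell_sq`, `sum_weights_weighted_le`), then `eq16_12_of_insertion`.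
[cite: Zhang2022LandauSiegel, §16 (16.10)–(16.12) p.92] -/
theorem eq16_12_of_eq16_5P_of_eq16_10_weighted (h5 : Eq16_5P c')
    (h10 : ∃ c₀ C : ℝ, ForAllLarge fun D _ χ => AssumptionA D χ →
      ∀ d l : ℕ, 1 ≤ d → 1 ≤ l →
        ((d * l : ℕ) : ℝ) < 2 * bigT D ^ 2 * (bigP D ^ (1 / 2 : ℝ) * max (Skeleton.P2 D) (P3 D)) →
        Nat.Coprime l D →
        ‖calD2 c' χ d l - lam2 c' χ d 1 * ∑ j ∈ ({1, 2} : Finset ℕ),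
            calR2 c' χ j * (d : ℂ) ^ betaJ c' D j * calM2 c' χ d l (1 - betaJ c' D j)‖ ≤
          C * (∏ q ∈ (d * l).primeFactors, (1 + c₀ / (q : ℝ) ^ (9 / 10 : ℝ))) * (ell D ^ 120)⁻¹) :
    Eq16_12 c' := by
  refine eq16_12_of_insertion c' h5 fun ε hε => ?_
  obtain ⟨c₀, C, h10'⟩ := h10
  -- WLOG the weight constant is `c₁ = |c₀| ≥ 0` and the error constant is `|C|`
  set c₁ : ℝ := |c₀| with hc₁
  have hc₁0 : 0 ≤ c₁ := abs_nonneg _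
  obtain ⟨K, hK0, hR⟩ := norm_calR2star_le c'
  set Cb : ℝ := (1 + ‖iota2‖) * (‖iota3‖ + ‖iota4‖) with hCb
  set Kc : ℝ := (1 + c₁) ^ (⌈c₁⌉₊ ^ 2 + 1) with hKc
  set Mτ : ℝ := MeanSquareMajorant.majorantConst 12 7 with hMτ
  have hMτ0 : 0 ≤ Mτ := (MeanSquareMajorant.majorantConst_pos _ _).le
  -- the constant in front of `𝓛^{2+108−120}`
  set K' : ℝ := K * (16 * Real.exp (11 / 2)) * (|C| * (Cb * Kc * Mτ * 2 ^ 12)) with hK'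
  have hK'0 : 0 ≤ K' := by positivity
  obtain ⟨D₂, hD₂⟩ := exists_forall_le_ell (max 10 (K' / ε + 1))
  obtain ⟨D₁, h₁⟩ := (h10'.and hR).and (self_div_totient_le_ell_sq)
  refine ⟨max D₁ D₂, fun D _ χ hD hq hp hA => ?_⟩
  have hD₁ : D₁ ≤ D := le_trans (le_max_left _ _) hD
  have hℓM := hD₂ D (le_trans (le_max_right _ _) hD)
  have hℓ : 10 ≤ ell D := le_trans (le_max_left _ _) hℓM
  have hℓε : K' / ε + 1 ≤ ell D := le_trans (le_max_right _ _) hℓM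
  have hℓ1 : 1 ≤ ell D := by linarith
  have hℓ0 : 0 < ell D := by linarith
  obtain ⟨⟨e10, eR⟩, eφ⟩ := h₁ D χ hD₁ hq hp
  have h10p := e10 hA
  have hRle := eR hA
  have hφle := eφ hA
  set N : ℕ := ⌈bigP D⌉₊ with hN
  set r : ℝ := (ell D ^ 120)⁻¹ with hr
  have hr0 : 0 < r := by positivity
  set w : ℕ → ℝ := fun n => ∏ q ∈ n.primeFactors, (1 + c₁ / (q : ℝ) ^ (9 / 10 : ℝ)) with hw
  have hw0 : ∀ n, 0 ≤ w n := fun n => Finset.prod_nonneg fun q _ => by positivity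
  -- `|∏(1 + c₀/q^{9/10})| ≤ ∏(1 + |c₀|/q^{9/10})`
  have hwabs : ∀ n : ℕ, |∏ q ∈ n.primeFactors, (1 + c₀ / (q : ℝ) ^ (9 / 10 : ℝ))| ≤ w n := by
    intro n
    rw [Finset.abs_prod]
    refine Finset.prod_le_prod (fun q _ => abs_nonneg _) fun q hq => ?_
    have hq9 : 0 < (q : ℝ) ^ (9 / 10 : ℝ) := by
      have : (0 : ℝ) < q := by exact_mod_cast (Nat.prime_of_mem_primeFactors hq).pos
      positivity
    calc |1 + c₀ / (q : ℝ) ^ (9 / 10 : ℝ)| ≤ |(1 : ℝ)| + |c₀ / (q : ℝ) ^ (9 / 10 : ℝ)| := abs_add_le _ _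
      _ = 1 + c₁ / (q : ℝ) ^ (9 / 10 : ℝ) := by rw [abs_one, abs_div, abs_of_pos hq9]
  -- pointwise: `‖w(d,l) E(d,l)‖ ≤ |b₁(dl)|/(dl) · w(dl) · (|C| r)` for `1 ≤ d, l`
  have hpt : ∀ d ∈ Finset.Ico 1 N, ∀ l ∈ Finset.Ico 1 N,
      ‖b1coef c' χ (d * l) * χ (l : ZMod D) / ((d : ℂ) * l) *
          (calD2 c' χ d l - lam2 c' χ d 1 * ∑ j ∈ ({1, 2} : Finset ℕ),
            calR2 c' χ j * (d : ℂ) ^ betaJ c' D j * calM2 c' χ d l (1 - betaJ c' D j))‖ ≤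
        ‖b1coef c' χ (d * l)‖ / ((d : ℝ) * l) * w (d * l) * (|C| * r) := by
    intro d hd l hl
    have hd1 : 1 ≤ d := (Finset.mem_Ico.mp hd).1
    have hl1 : 1 ≤ l := (Finset.mem_Ico.mp hl).1
    have hdl0 : (0 : ℝ) < (d : ℝ) * l := by positivity
    have hrhs0 : 0 ≤ ‖b1coef c' χ (d * l)‖ / ((d : ℝ) * l) * w (d * l) * (|C| * r) := by
      have := hw0 (d * l); positivity
    rw [norm_mul, norm_div, norm_mul, show ‖((d : ℂ) * l)‖ = (d : ℝ) * l by
      rw [norm_mul, Complex.norm_natCast, Complex.norm_natCast]]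
    by_cases hb : b1coef c' χ (d * l) = 0
    · rw [hb]; simp
    by_cases hχ : χ (l : ZMod D) = 0
    · rw [hχ]; simpa using hrhs0
    have hrange : ((d * l : ℕ) : ℝ) < 2 * bigT D ^ 2 * (bigP D ^ (1 / 2 : ℝ) * max (Skeleton.P2 D) (P3 D)) := by
      by_contra hge
      exact hb (b1coef_eq_zero_of_le c' χ (not_lt.mp hge))
    have hcop : Nat.Coprime l D := by
      have hu : IsUnit (l : ZMod D) := by
        by_contra hnu
        exact hχ (χ.map_nonunit hnu)
      exact (ZMod.isUnit_iff_coprime l D).mp hu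
    have hE := h10p d l hd1 hl1 hrange hcop
    have hE' : ‖calD2 c' χ d l - lam2 c' χ d 1 * ∑ j ∈ ({1, 2} : Finset ℕ),
        calR2 c' χ j * (d : ℂ) ^ betaJ c' D j * calM2 c' χ d l (1 - betaJ c' D j)‖ ≤
        |C| * w (d * l) * r := by
      refine hE.trans ?_
      calc C * (∏ q ∈ (d * l).primeFactors, (1 + c₀ / (q : ℝ) ^ (9 / 10 : ℝ))) * r
          ≤ |C * (∏ q ∈ (d * l).primeFactors, (1 + c₀ / (q : ℝ) ^ (9 / 10 : ℝ))) * r| := le_abs_self _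
        _ = |C| * |∏ q ∈ (d * l).primeFactors, (1 + c₀ / (q : ℝ) ^ (9 / 10 : ℝ))| * r := by
            rw [abs_mul, abs_mul, abs_of_pos hr0]
        _ ≤ |C| * w (d * l) * r :=
            mul_le_mul_of_nonneg_right (mul_le_mul_of_nonneg_left (hwabs _) (abs_nonneg _)) hr0.le
    have hχ1 : ‖χ (l : ZMod D)‖ ≤ 1 := DirichletCharacter.norm_le_one χ _
    calc ‖b1coef c' χ (d * l)‖ * ‖χ (l : ZMod D)‖ / ((d : ℝ) * l) *
          ‖calD2 c' χ d l - lam2 c' χ d 1 * ∑ j ∈ ({1, 2} : Finset ℕ),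
            calR2 c' χ j * (d : ℂ) ^ betaJ c' D j * calM2 c' χ d l (1 - betaJ c' D j)‖
        ≤ ‖b1coef c' χ (d * l)‖ * 1 / ((d : ℝ) * l) * (|C| * w (d * l) * r) := by
          refine mul_le_mul ?_ hE' (norm_nonneg _) (by positivity)
          exact div_le_div_of_nonneg_right (mul_le_mul_of_nonneg_left hχ1 (norm_nonneg _)) hdl0.le
      _ = ‖b1coef c' χ (d * l)‖ / ((d : ℝ) * l) * w (d * l) * (|C| * r) := by ring
  -- sum up
  have hsum : ‖∑ d ∈ Finset.Ico 1 N, ∑ l ∈ Finset.Ico 1 N,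
      b1coef c' χ (d * l) * χ (l : ZMod D) / ((d : ℂ) * l) *
        (calD2 c' χ d l - lam2 c' χ d 1 * ∑ j ∈ ({1, 2} : Finset ℕ),
          calR2 c' χ j * (d : ℂ) ^ betaJ c' D j * calM2 c' χ d l (1 - betaJ c' D j))‖ ≤
      (Cb * Kc * Mτ * (2 * ell D ^ 9) ^ 12) * (|C| * r) := by
    refine (norm_sum_le _ _).trans ?_
    refine (Finset.sum_le_sum fun d hd => (norm_sum_le _ _).trans
      (Finset.sum_le_sum fun l hl => hpt d hd l hl)).trans ?_
    simp_rw [← Finset.sum_mul]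
    refine mul_le_mul_of_nonneg_right ?_ (by positivity)
    have h := sum_weights_weighted_le c' χ hℓ hc₁0
    simpa only [hw, hCb, hKc, hMτ] using h
  have hfinal : K' / ell D ≤ ε := by
    rw [div_le_iff₀ hℓ0]
    have h1 : K' / ε ≤ ell D := by linarith
    have h2 := (div_le_iff₀ hε).mp h1
    linarith
  have hpow : ell D ^ 2 * (2 * ell D ^ 9) ^ 12 * r = 2 ^ 12 / ell D ^ 10 := by
    simp only [hr]; field_simp
  have hℓ10 : ell D ≤ ell D ^ 10 := le_self_pow₀ hℓ1 (by norm_num)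
  calc ‖calR2star c' χ‖ * ((D : ℝ) / (Nat.totient D : ℝ)) *
        ‖∑ d ∈ Finset.Ico 1 N, ∑ l ∈ Finset.Ico 1 N,
          b1coef c' χ (d * l) * χ (l : ZMod D) / ((d : ℂ) * l) *
            (calD2 c' χ d l - lam2 c' χ d 1 * ∑ j ∈ ({1, 2} : Finset ℕ),
              calR2 c' χ j * (d : ℂ) ^ betaJ c' D j * calM2 c' χ d l (1 - betaJ c' D j))‖
      ≤ K * (16 * Real.exp (11 / 2) * ell D ^ 2) *
          ((Cb * Kc * Mτ * (2 * ell D ^ 9) ^ 12) * (|C| * r)) := by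
        have hφ0 : 0 ≤ (D : ℝ) / (Nat.totient D : ℝ) := by positivity
        exact mul_le_mul (mul_le_mul hRle hφle hφ0 hK0) hsum (norm_nonneg _) (by positivity)
    _ = K * (16 * Real.exp (11 / 2)) * (|C| * (Cb * Kc * Mτ)) * (ell D ^ 2 * (2 * ell D ^ 9) ^ 12 * r) := by
        ring
    _ = K * (16 * Real.exp (11 / 2)) * (|C| * (Cb * Kc * Mτ)) * (2 ^ 12 / ell D ^ 10) := by rw [hpow]
    _ = K' / ell D ^ 10 := by simp only [hK']; ring
    _ ≤ K' / ell D := div_le_div_of_nonneg_left hK'0 hℓ0 hℓ10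
    _ ≤ ε := hfinal

/-- **(16.12) ⇐ (16.5)ᴾ + (16.10) with a UNIFORM polynomial rate on the support of `b₁`** (the shape
«(16.10)ᴿ» of WP16's RT16-int-2: error `C·𝓛⁻¹²⁰`, no weight): the special case `c₀ = 0` of
`eq16_12_of_eq16_5P_of_eq16_10_weighted` (the empty weight `∏(1 + 0/q^{9/10}) = 1`).
[cite: Zhang2022LandauSiegel, §16 (16.10)–(16.12) p.92] -/
theorem eq16_12_of_eq16_5P_of_eq16_10R_on_support (h5 : Eq16_5P c')
    (h10 : ∃ C : ℝ, ForAllLarge fun D _ χ => AssumptionA D χ →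
      ∀ d l : ℕ, 1 ≤ d → 1 ≤ l →
        ((d * l : ℕ) : ℝ) < 2 * bigT D ^ 2 * (bigP D ^ (1 / 2 : ℝ) * max (Skeleton.P2 D) (P3 D)) →
        Nat.Coprime l D →
        ‖calD2 c' χ d l - lam2 c' χ d 1 * ∑ j ∈ ({1, 2} : Finset ℕ),
            calR2 c' χ j * (d : ℂ) ^ betaJ c' D j * calM2 c' χ d l (1 - betaJ c' D j)‖ ≤
          C * (ell D ^ 120)⁻¹) :
    Eq16_12 c' := by
  obtain ⟨C, D₀, hD₀⟩ := h10
  refine eq16_12_of_eq16_5P_of_eq16_10_weighted c' h5 ⟨0, C, D₀, fun D _ χ hD hq hp hA d l hd hl hdl hcop => ?_⟩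
  simpa only [zero_div, add_zero, Finset.prod_const_one, mul_one] using hD₀ D χ hD hq hp hA d l hd hl hdl hcop

end Main

end Literature.NumberTheory.LFunctions.Zhang2022.Typed.Section16A
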